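import Literature.Analysis.FunctionSpaces.TorusMollifierEstimates
import Literature.Analysis.FunctionSpaces.TorusMollifiedFields
import Literature.Analysis.FunctionSpaces.TorusTestFunction
import HarnessLib

/-!
# The Constantin–E–Titi commutator estimate on `T^d`

Analysis/FunctionSpaces support file (serves the discharge of Onsager rigidity,
`Literature.Analysis.FluidPDE.onsager_rigidity`, `FluidPDE/Onsager`; Constantin–E–Titi 1994, (9)–(11) of the proof).
For the standard mollifier `k_ε = Torus.kernel ε` and real functions `f, g` on the flat torus:

* `Torus.convolution_mul_sub_mul_convolution` — **the CET identity (10)**, pointwise: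
  `((fg) ⋆ k_ε) - (f ⋆ k_ε)(g ⋆ k_ε) = r_ε(f, g) - (f - f ⋆ k_ε)(g - g ⋆ k_ε)` with
  `r_ε(f, g)(x) = ∫ k_ε(y) (f(x - y) - f(x)) (g(x - y) - g(x)) dy` (CET (9));
* `Torus.eLpNorm_commutatorRemainder_le` — `‖r_ε(f,g)‖_{L^{3/2}} ≤ A_f A_g` for translation moduli
  `A_f, A_g` in `L³` at scale `ε` (Minkowski–Jensen and Hölder);
* `Torus.lintegral_commutator_mul_le` — **the flux bound (11)**, scalar form:
  `∫ |((fg) ⋆ k_ε - (f ⋆ k_ε)(g ⋆ k_ε)) L| ≤ 2 A_f A_g ‖L‖_{L³}`;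
* the vector glue for velocity fields `u : T^d → ℝ^d`: the componentwise mollification
  `Torus.vecMollify ε u` (`TorusMollifiedFields`) is divergence free when `u` is weakly divergence free
  (`Torus.isDivFree_vecMollify`), and `∑ᵢⱼ ∫ uᵢ^ε uⱼ^ε ∂ⱼuᵢ^ε = 0`
  (`Torus.integral_sum_mul_mul_partialDeriv_vecMollify_eq_zero`, the tree's transport identity
  `Torus.integral_inner_convect_self_eq_zero`);
* `Torus.abs_integral_flux_vecMollify_le` — **CET (11) for velocity fields**:
  `|∫ ∑ᵢⱼ ((uᵢuⱼ) ⋆ k_ε) ∂ⱼuᵢ^ε| ≤ 2 d² C₁ A³ / ε` when the `L³` translation modulus of `u` at scale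
  `ε` is `≤ A`; with the Besov modulus `A = [u]_{B^α_{3,∞}} ε^α` this is the printed
  `O(ε^{3α - 1})` bound.

## Mathlib search

Mathlib (this pin) has Hölder's inequality in the form `eLpNorm_smul_le_mul_eLpNorm` with the
`ENNReal.HolderTriple` class (instances for the exponents `(3, 3, 3/2)` and `(3/2, 3, 1)` are
provided here as theorems) and no mollifier commutator estimates (searched `commutator`,
`convolution_mul` in `Mathlib/Analysis/Convolution`, `MeasureTheory`).

## References

* P. Constantin, W. E, E. S. Titi, *Onsager's conjecture on the energy conservation for solutions
  of Euler's equation*, Comm. Math. Phys. 165 (1994), 207–209, (9)–(11).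
-/

noncomputable section

open MeasureTheory TopologicalSpace Set Function Filter Topology Metric ContinuousLinearMap
open scoped ENNReal NNReal Convolution InnerProductSpace RealInnerProductSpace

namespace Literature.Analysis.FunctionSpaces

/-! ## Hölder exponents `(3, 3, 3/2)` and `(3/2, 3, 1)` -/

section Exponents

/-- `3⁻¹ + 3⁻¹ = (3/2)⁻¹` in `ℝ≥0∞`: the Hölder triple `(3, 3, 3/2)`. [folklore] -/
theorem holderTriple_three_three : ENNReal.HolderTriple 3 3 (3 / 2) := by
  constructor
  rw [ENNReal.inv_div (Or.inr (by norm_num)) (Or.inr (by norm_num)), ← two_mul, div_eq_mul_inv]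

/-- `2/3 + 3⁻¹ = 1` in `ℝ≥0∞`. [folklore] -/
theorem ennreal_two_div_three_add_inv_three : (2 : ℝ≥0∞) / 3 + 3⁻¹ = 1 := by
  rw [show (3 : ℝ≥0∞)⁻¹ = 1 / 3 by rw [one_div], ENNReal.div_add_div_same]
  norm_num
  exact ENNReal.div_self (by norm_num) (by norm_num)

/-- `(3/2)⁻¹ + 3⁻¹ = 1⁻¹` in `ℝ≥0∞`: the Hölder triple `(3/2, 3, 1)`. [folklore] -/
theorem holderTriple_threeHalves_three : ENNReal.HolderTriple (3 / 2) 3 1 := by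
  constructor
  rw [ENNReal.inv_div (Or.inr (by norm_num)) (Or.inr (by norm_num)), inv_one,
    ennreal_two_div_three_add_inv_three]

/-- `1 ≤ 3/2` in `ℝ≥0∞`. [folklore] -/
theorem ennreal_one_le_three_halves : (1 : ℝ≥0∞) ≤ 3 / 2 := by
  rw [ENNReal.le_div_iff_mul_le (by norm_num) (by norm_num)]; norm_num

/-- `3/2 ≠ ∞` in `ℝ≥0∞`. [folklore] -/
theorem ennreal_three_halves_ne_top : (3 / 2 : ℝ≥0∞) ≠ ⊤ :=
  ENNReal.div_ne_top (by norm_num) (by norm_num)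

variable {α : Type*} [MeasurableSpace α] {μ : Measure α}

/-- Hölder `L³ · L³ ⊂ L^{3/2}` for real functions. [folklore] -/
theorem eLpNorm_mul_threeHalves_le {f g : α → ℝ} (hf : AEStronglyMeasurable f μ)
    (hg : AEStronglyMeasurable g μ) :
    eLpNorm (fun x => f x * g x) (3 / 2) μ ≤ eLpNorm f 3 μ * eLpNorm g 3 μ := by
  have h := @eLpNorm_smul_le_mul_eLpNorm _ _ _ _ μ _ _ _ _ 3 3 (3 / 2) g hg f hf
    holderTriple_three_three
  exact h

/-- Hölder `∫ |f g| ≤ ‖f‖_{L^{3/2}} ‖g‖_{L³}` for real functions. [folklore] -/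
theorem lintegral_enorm_mul_le_threeHalves_three {f g : α → ℝ} (hf : AEStronglyMeasurable f μ)
    (hg : AEStronglyMeasurable g μ) :
    ∫⁻ x, ‖f x * g x‖ₑ ∂μ ≤ eLpNorm f (3 / 2) μ * eLpNorm g 3 μ := by
  have h := @eLpNorm_smul_le_mul_eLpNorm _ _ _ _ μ _ _ _ _ (3 / 2) 3 1 g hg f hf
    holderTriple_threeHalves_three
  rw [eLpNorm_one_eq_lintegral_enorm] at h
  exact h

end Exponents

/-! ## Componentwise mollification of vector fields -/

namespace Torus

variable {d : Type*} [Fintype d] {ε : ℝ}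

section DivFree

variable [DecidableEq d]

/-- The divergence of the mollified field is the pairing of `u` with a gradient:
`div u^ε (x) = -∫ ⟪u(y), ∇_y k_ε(x - y)⟫ dy`. [folklore] -/
theorem divergence_vecMollify {u : UnitAddTorus d → EuclideanSpace ℝ d} (hu : Integrable u volume)
    (hε : 0 < ε) (hε' : ε ≤ 1 / 4) (x : UnitAddTorus d) :
    divergence (vecMollify ε u) x =
      -∫ y, ⟪u y, Torus.gradient (fun y => kernel ε (x - y)) y⟫_ℝ := by
  have hk := isSmooth_kernel (d := d) hε hε'
  have hk1 : IsContDiff 1 (kernel (d := d) ε) := hk.isContDiff (by simp)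
  have hcomp : ∀ i, (fun y => vecMollify ε u y i) = (fun y => u y i) ⋆ kernel ε := fun i => rfl
  simp only [divergence, hcomp, partialDeriv_convolution (hu.eval_piLp _) hk, convolution_lsmul]
  rw [← integral_finsetSum _ fun i _ =>
      integrable_smul_comp_sub (hu.eval_piLp i) (hk.partialDeriv i).continuous x,
    ← integral_neg]
  refine integral_congr_ae (Eventually.of_forall fun y => ?_)
  dsimp only
  rw [gradient_comp_sub_left, inner_neg_right, neg_neg, gradient_eq_sum_partialDeriv hk1, inner_sum]
  refine Finset.sum_congr rfl fun i _ => ?_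
  rw [real_inner_smul_right, EuclideanSpace.inner_single_right]
  simp [smul_eq_mul, mul_comm]

/-- **Mollification of a weakly divergence-free field is divergence free** (test the weak
condition with the smooth function `y ↦ k_ε(x - y)`). [folklore] -/
theorem isDivFree_vecMollify {u : UnitAddTorus d → EuclideanSpace ℝ d} (hu : Integrable u volume)
    (hdiv : IsWeaklyDivFree u) (hε : 0 < ε) (hε' : ε ≤ 1 / 4) : IsDivFree (vecMollify ε u) := by
  intro x
  rw [divergence_vecMollify hu hε hε', hdiv _ ((isSmooth_kernel hε hε').comp_sub_left x), neg_zero]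

/-- For a smooth divergence-free field, `∑ᵢⱼ ∫ vᵢ vⱼ ∂ⱼvᵢ = 0`; this is the tree's transport
identity `∫ ⟪(v·∇)v, v⟫ = 0` written in coordinates. [folklore] -/
theorem integral_sum_mul_mul_partialDeriv_eq_zero {v : UnitAddTorus d → EuclideanSpace ℝ d}
    (hv : IsSmooth v) (hdiv : IsDivFree v) :
    ∫ x, ∑ i, ∑ j, v x i * v x j * partialDeriv j (fun y => v y i) x = 0 := by
  have hv1 : IsContDiff 1 v := hv.isContDiff (by simp)
  have h := integral_inner_convect_self_eq_zero hv hdiv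
  rw [← h]
  refine integral_congr_ae (Eventually.of_forall fun x => ?_)
  simp only [Torus.convect]
  rw [real_inner_comm, PiLp.inner_apply]
  refine Finset.sum_congr rfl fun i _ => ?_
  have hcomp : (Torus.fderiv v x (v x)) i = Torus.fderiv (fun y => v y i) x (v x) := by
    have hd : HasFDerivAt (liftAt v x) (Torus.fderiv v x) 0 :=
      (((hv.liftAt x).differentiable (by simp)).differentiableAt).hasFDerivAt
    have h2 := ((EuclideanSpace.proj i).hasFDerivAt.comp (0 : EuclideanSpace ℝ d) hd).fderiv
    have h3 : Torus.fderiv (fun y => v y i) x = (EuclideanSpace.proj i).comp (Torus.fderiv v x) := by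
      rw [Torus.fderiv, ← h2]
      rfl
    rw [h3]
    rfl
  rw [hcomp, fderiv_apply_eq_sum_partialDeriv ((hv.apply i).isContDiff (by simp))]
  simp only [RCLike.inner_apply, conj_trivial, smul_eq_mul]
  rw [Finset.sum_mul]
  refine Finset.sum_congr rfl fun j _ => ?_
  ring

end DivFree

/-! ## The CET identity (10) and the remainder `r_ε` (9) -/

/-- **The Constantin–E–Titi identity**, pointwise (Constantin–E–Titi 1994, (10), scalar pair
form): for real `f, g` with `f`, `g`, `fg` integrable,
`((fg) ⋆ k_ε)(x) - (f ⋆ k_ε)(x) (g ⋆ k_ε)(x) = r_ε(f,g)(x) - (f(x) - (f ⋆ k_ε)(x)) (g(x) - (g ⋆ k_ε)(x))`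
with `r_ε(f,g)(x) = ∫ k_ε(y) (f(x-y) - f(x)) (g(x-y) - g(x)) dy`. [cite: ConstantinETiti1994, (10)] -/
theorem convolution_mul_sub_mul_convolution {f g : UnitAddTorus d → ℝ} (hf : Integrable f volume)
    (hg : Integrable g volume) (hfg : Integrable (fun x => f x * g x) volume) (hε : 0 < ε)
    (hε' : ε ≤ 1 / 4) (x : UnitAddTorus d) :
    ((fun y => f y * g y) ⋆ kernel ε) x - (f ⋆ kernel ε) x * (g ⋆ kernel ε) x =
      (∫ y, kernel ε y * ((f (x - y) - f x) * (g (x - y) - g x))) -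
        (f x - (f ⋆ kernel ε) x) * (g x - (g ⋆ kernel ε) x) := by
  have hk := continuous_kernel (d := d) hε hε'
  -- the three mollifications as kernel averages
  have e1 : ((fun y => f y * g y) ⋆ kernel ε) x = ∫ y, kernel ε y * (f (x - y) * g (x - y)) := by
    rw [convolution_comm_real, convolution_lsmul]; rfl
  have e2 : (f ⋆ kernel ε) x = ∫ y, kernel ε y * f (x - y) := by
    rw [convolution_comm_real, convolution_lsmul]; rfl
  have e3 : (g ⋆ kernel ε) x = ∫ y, kernel ε y * g (x - y) := by
    rw [convolution_comm_real, convolution_lsmul]; rfl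
  have i1 : Integrable (fun y => kernel ε y * (f (x - y) * g (x - y))) volume :=
    integrable_kernel_smul_comp_sub hfg hk x
  have i2 : Integrable (fun y => kernel ε y * f (x - y)) volume :=
    integrable_kernel_smul_comp_sub hf hk x
  have i3 : Integrable (fun y => kernel ε y * g (x - y)) volume :=
    integrable_kernel_smul_comp_sub hg hk x
  have ik : Integrable (kernel (d := d) ε) volume := hk.integrable_unitAddTorus
  -- expand the remainder
  have er : ∫ y, kernel ε y * ((f (x - y) - f x) * (g (x - y) - g x)) =
      (∫ y, kernel ε y * (f (x - y) * g (x - y))) - g x * (∫ y, kernel ε y * f (x - y)) -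
        f x * (∫ y, kernel ε y * g (x - y)) + f x * g x * ∫ y : UnitAddTorus d, kernel ε y := by
    have h : (fun y => kernel ε y * ((f (x - y) - f x) * (g (x - y) - g x))) =
        fun y => kernel ε y * (f (x - y) * g (x - y)) - g x * (kernel ε y * f (x - y)) -
          f x * (kernel ε y * g (x - y)) + f x * g x * kernel ε y := by
      funext y; ring
    have j1 : Integrable (fun y => kernel ε y * (f (x - y) * g (x - y)) -
        g x * (kernel ε y * f (x - y))) volume := i1.sub (i2.const_mul _)
    have j2 : Integrable (fun y => kernel ε y * (f (x - y) * g (x - y)) -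
        g x * (kernel ε y * f (x - y)) - f x * (kernel ε y * g (x - y))) volume :=
      j1.sub (i3.const_mul _)
    have j3 : Integrable (fun y => f x * g x * kernel ε y) volume := ik.const_mul _
    rw [h, integral_add j2 j3, integral_sub j1 (i3.const_mul _), integral_sub i1 (i2.const_mul _),
      integral_const_mul, integral_const_mul, integral_const_mul]
  rw [er, e1, e2, e3, integral_kernel hε hε']
  ring

/-- Measurability of the remainder integrand `(x, y) ↦ (f(x-y) - f(x)) (g(x-y) - g(x))`. [folklore] -/
theorem aestronglyMeasurable_diff_mul_diff {f g : UnitAddTorus d → ℝ} (hf : AEStronglyMeasurable f volume)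
    (hg : AEStronglyMeasurable g volume) :
    AEStronglyMeasurable (uncurry fun x y : UnitAddTorus d => (f (x - y) - f x) * (g (x - y) - g x))
      ((volume : Measure (UnitAddTorus d)).prod volume) :=
  (aestronglyMeasurable_comp_sub_sub hf).mul (aestronglyMeasurable_comp_sub_sub hg)

/-- **CET (9)–(11): the remainder is small in `L^{3/2}`.** If the `L³` translation moduli of
`f`, `g` at scale `ε` are at most `Af`, `Ag`, then
`‖r_ε(f,g)‖_{L^{3/2}} ≤ Af · Ag` (Minkowski–Jensen with the unit-mass kernel and Hölder
`L³ · L³ ⊂ L^{3/2}`; Constantin–E–Titi 1994, the bound `‖r_ε(u,u)‖_{3/2} ≤ C ε^{2α} ‖u‖²`).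
[cite: ConstantinETiti1994, (11)] -/
theorem eLpNorm_commutatorRemainder_le {f g : UnitAddTorus d → ℝ} (hf : AEStronglyMeasurable f volume)
    (hg : AEStronglyMeasurable g volume) (hε : 0 < ε) (hε' : ε ≤ 1 / 4) {Af Ag : ℝ≥0∞}
    (hAf : ∀ y : UnitAddTorus d, ‖y‖ ≤ ε → eLpNorm (fun x => f (x - y) - f x) 3 volume ≤ Af)
    (hAg : ∀ y : UnitAddTorus d, ‖y‖ ≤ ε → eLpNorm (fun x => g (x - y) - g x) 3 volume ≤ Ag) :
    eLpNorm (fun x => ∫ y, kernel ε y * ((f (x - y) - f x) * (g (x - y) - g x))) (3 / 2) volume ≤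
      Af * Ag := by
  have h := eLpNorm_integral_smul_le_mul (F := ℝ) (continuous_kernel hε hε').aestronglyMeasurable
    (aestronglyMeasurable_diff_mul_diff hf hg) ennreal_one_le_three_halves ennreal_three_halves_ne_top
    (A := Af * Ag) (Eventually.of_forall fun y hy => ?_)
  · rw [lintegral_enorm_kernel hε hε', one_mul] at h
    exact h
  · have hy' : ‖y‖ ≤ ε := (mem_ball_zero_iff.1 (support_kernel_subset hε hy)).le
    have hfm : AEStronglyMeasurable (fun x => f (x - y) - f x) volume :=
      (hf.comp_quasiMeasurePreserving (measurePreserving_sub_right volume y).quasiMeasurePreserving).sub hf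
    have hgm : AEStronglyMeasurable (fun x => g (x - y) - g x) volume :=
      (hg.comp_quasiMeasurePreserving (measurePreserving_sub_right volume y).quasiMeasurePreserving).sub hg
    exact (eLpNorm_mul_threeHalves_le hfm hgm).trans (mul_le_mul' (hAf y hy') (hAg y hy'))

/-- **The flux bound (11), scalar pair form.** With `L³` translation moduli `Af`, `Ag` at scale
`ε` and any measurable `L`:
`∫ |((fg) ⋆ k_ε - (f ⋆ k_ε)(g ⋆ k_ε)) · L| ≤ 2 Af Ag ‖L‖_{L³}` (the CET identity, the remainder
bound, CET (6) for the product of errors, and Hölder `L^{3/2} · L³ ⊂ L¹`; Constantin–E–Titi 1994,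
(11)). [cite: ConstantinETiti1994, (11)] -/
theorem lintegral_commutator_mul_le {f g : UnitAddTorus d → ℝ} (hf : MemLp f 2 volume)
    (hg : MemLp g 2 volume) (hε : 0 < ε) (hε' : ε ≤ 1 / 4) {Af Ag : ℝ≥0∞}
    (hAf : ∀ y : UnitAddTorus d, ‖y‖ ≤ ε → eLpNorm (fun x => f (x - y) - f x) 3 volume ≤ Af)
    (hAg : ∀ y : UnitAddTorus d, ‖y‖ ≤ ε → eLpNorm (fun x => g (x - y) - g x) 3 volume ≤ Ag)
    {L : UnitAddTorus d → ℝ} (hL : AEStronglyMeasurable L volume) :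
    ∫⁻ x, ‖(((fun y => f y * g y) ⋆ kernel ε) x - (f ⋆ kernel ε) x * (g ⋆ kernel ε) x) * L x‖ₑ ≤
      2 * Af * Ag * eLpNorm L 3 volume := by
  have hfi : Integrable f volume := hf.integrable one_le_two
  have hgi : Integrable g volume := hg.integrable one_le_two
  have hfg : Integrable (fun x => f x * g x) volume := hf.integrable_mul hg
  have hk := continuous_kernel (d := d) hε hε'
  set r : UnitAddTorus d → ℝ := fun x => ∫ y, kernel ε y * ((f (x - y) - f x) * (g (x - y) - g x))
    with hr
  set ef : UnitAddTorus d → ℝ := fun x => f x - (f ⋆ kernel ε) x with hef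
  set eg : UnitAddTorus d → ℝ := fun x => g x - (g ⋆ kernel ε) x with heg
  -- measurability
  have hcf : Continuous (f ⋆ kernel ε) := continuous_convolution hfi hk
  have hcg : Continuous (g ⋆ kernel ε) := continuous_convolution hgi hk
  have hefm : AEStronglyMeasurable ef volume := hf.1.sub hcf.aestronglyMeasurable
  have hegm : AEStronglyMeasurable eg volume := hg.1.sub hcg.aestronglyMeasurable
  have hrm : AEStronglyMeasurable r volume := by
    have := (aestronglyMeasurable_diff_mul_diff hf.1 hg.1)
    exact ((hk.aestronglyMeasurable.comp_snd (μ := volume)).mul this).integral_prod_right'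
  -- pointwise identity and splitting
  have hpt : ∀ x, (((fun y => f y * g y) ⋆ kernel ε) x - (f ⋆ kernel ε) x * (g ⋆ kernel ε) x) * L x =
      r x * L x - ef x * eg x * L x := fun x => by
    rw [convolution_mul_sub_mul_convolution hfi hgi hfg hε hε' x]
    ring
  -- error norms: CET (6) with exponent 3
  have hε3 : ∀ {φ : UnitAddTorus d → ℝ} (hφ : Integrable φ volume) {A : ℝ≥0∞},
      (∀ y : UnitAddTorus d, ‖y‖ ≤ ε → eLpNorm (fun x => φ (x - y) - φ x) 3 volume ≤ A) →
      eLpNorm (fun x => φ x - (φ ⋆ kernel ε) x) 3 volume ≤ A := by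
    intro φ hφ A hA
    have h := eLpNorm_convolution_kernel_sub_self_le hφ hε hε' (p := 3) (by norm_num)
      ENNReal.ofNat_ne_top hA
    rw [← eLpNorm_neg]
    convert h using 2
    funext x
    simp
  calc ∫⁻ x, ‖(((fun y => f y * g y) ⋆ kernel ε) x - (f ⋆ kernel ε) x * (g ⋆ kernel ε) x) * L x‖ₑ
      = ∫⁻ x, ‖r x * L x - ef x * eg x * L x‖ₑ := by simp_rw [hpt]
    _ ≤ ∫⁻ x, ‖r x * L x‖ₑ + ‖(ef x * eg x) * L x‖ₑ := lintegral_mono fun x => enorm_sub_le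
    _ = (∫⁻ x, ‖r x * L x‖ₑ) + ∫⁻ x, ‖(ef x * eg x) * L x‖ₑ :=
        lintegral_add_left' ((hrm.mul hL).enorm) _
    _ ≤ eLpNorm r (3 / 2) volume * eLpNorm L 3 volume +
          eLpNorm (fun x => ef x * eg x) (3 / 2) volume * eLpNorm L 3 volume :=
        add_le_add (lintegral_enorm_mul_le_threeHalves_three hrm hL)
          (lintegral_enorm_mul_le_threeHalves_three (hefm.mul hegm) hL)
    _ ≤ Af * Ag * eLpNorm L 3 volume + Af * Ag * eLpNorm L 3 volume := by
        gcongr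
        · exact eLpNorm_commutatorRemainder_le hf.1 hg.1 hε hε' hAf hAg
        · exact (eLpNorm_mul_threeHalves_le hefm hegm).trans
            (mul_le_mul' (hε3 hfi hAf) (hε3 hgi hAg))
    _ = 2 * Af * Ag * eLpNorm L 3 volume := by ring

/-! ## The flux bound for velocity fields -/

section Flux

variable [DecidableEq d]

/-- **CET (11) for velocity fields.** Let `u ∈ L³(T^d; ℝ^d)` be weakly divergence free with
`L³` translation modulus at most `A < ∞` at scale `ε` (`0 < ε ≤ 1/4`). Then the energy flux
through the mollified field satisfies
`|∫ ∑ᵢⱼ ((uᵢuⱼ) ⋆ k_ε) ∂ⱼ(u^ε)ᵢ| ≤ d² · 2 A² · (C₁/ε) A`: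
subtract `∑ᵢⱼ ∫ uᵢ^ε uⱼ^ε ∂ⱼuᵢ^ε = 0` (incompressibility of `u^ε`) and apply the scalar flux
bound to each of the `d²` commutators with `L = ∂ⱼ(u^ε)ᵢ`, `‖L‖_{L³} ≤ (C₁/ε) A` (CET (7))
(Constantin–E–Titi 1994, (11) and the display following (12)). [cite: ConstantinETiti1994, (11)] -/
theorem abs_integral_flux_vecMollify_le {u : UnitAddTorus d → EuclideanSpace ℝ d}
    (hu : MemLp u 3 volume) (hdiv : IsWeaklyDivFree u) (hε : 0 < ε) (hε' : ε ≤ 1 / 4) {A : ℝ≥0∞}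
    (hAtop : A ≠ ⊤)
    (hA : ∀ y : UnitAddTorus d, ‖y‖ ≤ ε → eLpNorm (fun x => u (x - y) - u x) 3 volume ≤ A) :
    |∫ x, ∑ i, ∑ j, ((fun y => u y i * u y j) ⋆ kernel ε) x *
        partialDeriv j (fun y => vecMollify ε u y i) x| ≤
      (Fintype.card d : ℝ) ^ 2 * (2 * A.toReal * A.toReal * ((ε⁻¹ * gradProfileMass d) * A.toReal)) := by
  -- notation and basic facts
  have hu2 : MemLp u 2 volume := hu.mono_exponent (by norm_num)
  have hui : Integrable u volume := hu.integrable (by norm_num)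
  have hci : ∀ i, Integrable (fun y => u y i) volume := fun i => hui.eval_piLp i
  have hc2 : ∀ i, MemLp (fun y => u y i) 2 volume := fun i => hu2.eval_piLp i
  have hc3 : ∀ i, MemLp (fun y => u y i) 3 volume := fun i => hu.eval_piLp i
  have hk := isSmooth_kernel (d := d) hε hε'
  have hkc := continuous_kernel (d := d) hε hε'
  have hAi : ∀ (i : d) (y : UnitAddTorus d), ‖y‖ ≤ ε →
      eLpNorm (fun x => u (x - y) i - u x i) 3 volume ≤ A := fun i y hy =>
    (eLpNorm_apply_comp_sub_sub_le i y 3).trans (hA y hy)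
  set v : UnitAddTorus d → EuclideanSpace ℝ d := vecMollify ε u with hv
  have hvs : IsSmooth v := isSmooth_vecMollify hui hε hε'
  have hvd : IsDivFree v := isDivFree_vecMollify hui hdiv hε hε'
  have hvi : ∀ i, (fun y => v y i) = (fun y => u y i) ⋆ kernel ε := fun i => rfl
  set T : d → d → UnitAddTorus d → ℝ := fun i j => (fun y => u y i * u y j) ⋆ kernel ε with hT
  set L : d → d → UnitAddTorus d → ℝ := fun i j => partialDeriv j (fun y => v y i) with hL
  have hTc : ∀ i j, Continuous (T i j) := fun i j =>
    continuous_convolution ((hc2 i).integrable_mul (hc2 j)) hkc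
  have hLc : ∀ i j, Continuous (L i j) := fun i j => ((hvs.apply i).partialDeriv j).continuous
  have hvc : ∀ i, Continuous (fun y => v y i) := fun i => (hvs.apply i).continuous
  -- `L³` bound for `L i j` (CET (7))
  have hL3 : ∀ i j, eLpNorm (L i j) 3 volume ≤ ENNReal.ofReal (ε⁻¹ * gradProfileMass d) * A := by
    intro i j
    simp only [hL, hvi]
    exact eLpNorm_partialDeriv_convolution_kernel_le (hci i) hε hε' (by norm_num)
      ENNReal.ofNat_ne_top (hAi i) j
  -- subtract the vanishing term `∑ᵢⱼ ∫ vᵢ vⱼ ∂ⱼvᵢ = 0`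
  have hzero := integral_sum_mul_mul_partialDeriv_eq_zero hvs hvd
  have hint1 : Integrable (fun x => ∑ i, ∑ j, T i j x * L i j x) volume :=
    (continuous_finsetSum _ fun i _ => continuous_finsetSum _ fun j _ =>
      (hTc i j).mul (hLc i j)).integrable_unitAddTorus
  have hint2 : Integrable (fun x => ∑ i, ∑ j, v x i * v x j * L i j x) volume :=
    (continuous_finsetSum _ fun i _ => continuous_finsetSum _ fun j _ =>
      ((hvc i).mul (hvc j)).mul (hLc i j)).integrable_unitAddTorus
  have hsub : ∫ x, ∑ i, ∑ j, T i j x * L i j x =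
      ∫ x, ∑ i, ∑ j, (T i j x - v x i * v x j) * L i j x := by
    rw [← sub_zero (∫ x, ∑ i, ∑ j, T i j x * L i j x), ← hzero, ← integral_sub hint1 hint2]
    refine integral_congr_ae (Eventually.of_forall fun x => ?_)
    simp only [sub_mul, Finset.sum_sub_distrib]
  -- each commutator term
  set B : ℝ := 2 * A.toReal * A.toReal * ((ε⁻¹ * gradProfileMass d) * A.toReal) with hB
  have hC₁ : 0 ≤ ε⁻¹ * gradProfileMass d :=
    mul_nonneg (inv_nonneg.2 hε.le) (gradProfileMass_nonneg (d := d))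
  have hterm : ∀ i j, |∫ x, (T i j x - v x i * v x j) * L i j x| ≤ B := by
    intro i j
    have hL3top : eLpNorm (L i j) 3 volume ≠ ⊤ :=
      ((hLc i j).memLp_of_hasCompactSupport (HasCompactSupport.of_compactSpace _)).eLpNorm_ne_top
    have h1 : ∫⁻ x, ‖(T i j x - v x i * v x j) * L i j x‖ₑ ≤ 2 * A * A * eLpNorm (L i j) 3 volume :=
      lintegral_commutator_mul_le (hc2 i) (hc2 j) hε hε' (hAi i) (hAi j)
        (hLc i j).aestronglyMeasurable
    have hfin : 2 * A * A * eLpNorm (L i j) 3 volume ≠ ⊤ :=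
      ENNReal.mul_ne_top (ENNReal.mul_ne_top (ENNReal.mul_ne_top (by norm_num) hAtop) hAtop) hL3top
    have hL3r : (eLpNorm (L i j) 3 volume).toReal ≤ (ε⁻¹ * gradProfileMass d) * A.toReal := by
      have := ENNReal.toReal_mono (ENNReal.mul_ne_top ENNReal.ofReal_ne_top hAtop) (hL3 i j)
      rwa [ENNReal.toReal_mul, ENNReal.toReal_ofReal hC₁] at this
    calc |∫ x, (T i j x - v x i * v x j) * L i j x|
        ≤ (∫⁻ x, ‖(T i j x - v x i * v x j) * L i j x‖ₑ).toReal := by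
          have h := norm_integral_le_lintegral_norm (μ := volume)
            (fun x => (T i j x - v x i * v x j) * L i j x)
          simp_rw [ofReal_norm] at h
          simpa only [Real.norm_eq_abs] using h
      _ ≤ (2 * A * A * eLpNorm (L i j) 3 volume).toReal := ENNReal.toReal_mono hfin h1
      _ ≤ B := by
          rw [ENNReal.toReal_mul, ENNReal.toReal_mul, ENNReal.toReal_mul, ENNReal.toReal_ofNat, hB]
          gcongr
  -- sum over the `d²` pairs
  rw [hsub]
  have hcij : ∀ i j, Integrable (fun x => (T i j x - v x i * v x j) * L i j x) volume := fun i j =>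
    (((hTc i j).sub ((hvc i).mul (hvc j))).mul (hLc i j)).integrable_unitAddTorus
  rw [integral_finsetSum _ fun i _ => integrable_finsetSum _ fun j _ => hcij i j]
  simp_rw [integral_finsetSum _ fun j _ => hcij _ j]
  calc |∑ i, ∑ j, ∫ x, (T i j x - v x i * v x j) * L i j x|
      ≤ ∑ i, |∑ j, ∫ x, (T i j x - v x i * v x j) * L i j x| := Finset.abs_sum_le_sum_abs _ _
    _ ≤ ∑ i, ∑ j, |∫ x, (T i j x - v x i * v x j) * L i j x| :=
        Finset.sum_le_sum fun i _ => Finset.abs_sum_le_sum_abs _ _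
    _ ≤ ∑ _i : d, ∑ _j : d, B := Finset.sum_le_sum fun i _ => Finset.sum_le_sum fun j _ => hterm i j
    _ = (Fintype.card d : ℝ) ^ 2 * B := by
        simp only [Finset.sum_const, Finset.card_univ]
        ring

/-- **CET (11) for velocity fields, Besov form.** For a weakly divergence-free
`u ∈ B^α_{3,∞}(T^d; ℝ^d)`, `0 < α`, and `0 < ε ≤ 1/4`:
`|∫ ∑ᵢⱼ ((uᵢuⱼ) ⋆ k_ε) ∂ⱼ(u^ε)ᵢ| ≤ 2 d² C₁ [u]³_{B^α_{3,∞}} ε^{3α - 1}` — the bound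
`|∫₀ᵗ∫ Tr(…)| ≤ C ε^{3α-1}` of Constantin–E–Titi 1994 (display after (12)) at a fixed time.
[cite: ConstantinETiti1994, (11)–(12)] -/
theorem abs_integral_flux_vecMollify_le_of_memBesovSup {u : UnitAddTorus d → EuclideanSpace ℝ d}
    {α : ℝ} (hα : 0 < α) (hB : MemBesovSup α 3 u volume) (hdiv : IsWeaklyDivFree u) (hε : 0 < ε)
    (hε' : ε ≤ 1 / 4) :
    |∫ x, ∑ i, ∑ j, ((fun y => u y i * u y j) ⋆ kernel ε) x *
        partialDeriv j (fun y => vecMollify ε u y i) x| ≤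
      (Fintype.card d : ℝ) ^ 2 * (2 * gradProfileMass d) *
        (eBesovSupSeminorm α 3 u volume).toReal ^ 3 * ε ^ (3 * α - 1) := by
  set S : ℝ≥0∞ := eBesovSupSeminorm α 3 u volume with hS
  have hStop : S ≠ ⊤ := hB.2.ne
  have hA : ∀ y : UnitAddTorus d, ‖y‖ ≤ ε →
      eLpNorm (fun x => u (x - y) - u x) 3 volume ≤ S * ENNReal.ofReal (ε ^ α) := fun y hy =>
    eLpNorm_comp_sub_sub_le_eBesovSupSeminorm hα hy
  have h := abs_integral_flux_vecMollify_le hB.1 hdiv hε hε'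
    (ENNReal.mul_ne_top hStop ENNReal.ofReal_ne_top) hA
  have hεα : 0 ≤ ε ^ α := Real.rpow_nonneg hε.le α
  rw [ENNReal.toReal_mul, ENNReal.toReal_ofReal hεα] at h
  refine h.trans (le_of_eq ?_)
  rw [Real.rpow_sub hε, Real.rpow_one, show (3 : ℝ) * α = α + α + α by ring, Real.rpow_add hε,
    Real.rpow_add hε]
  field_simp

end Flux

end Torus

end Literature.Analysis.FunctionSpaces
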